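import Summits.QuantumFields.BalabanUV.Beta.FP.DressedEntryWardInvariance
import Summits.QuantumFields.BalabanUV.Beta.FP.StepKernelWardDataRecord
import Summits.QuantumFields.BalabanUV.Gaps.D1RecordIndexSymmetry
import Summits.QuantumFields.BalabanUV.Beta.CompositeOneShotJetData

/-!
# `BalabanUV.Beta.FP.TowerFAnchorWardRecord` — road «FP», binder row D1, ROUTE T, the (H5-F) option (3a) (road FINDING FP-70, journal [D1P3-G62-A2]; an2 g85 W-2 §10, W-3 (a)):
# **AT THE ANCHOR STOREY THE TABLE HALF OF `hWT` IS A TREE THEOREM — `hWT 0` (hence the END consumer's `hF₁`) FROM `hgauge 0` ALONE**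

WHY (road A-2 = FINDING FP-70; an2 W-3 Q-an2-85-1 (a): the END dresses its F-family by the RENORMALISED true weight `wF′ 0 := (α 0)⁻¹ • wF Lc Q ℓ sn 0` (an2 PART 96), so that
`wF′ 0 − wStep Lc 1` is a pure gauge mode).  Under option (3a) the END consumer's anchor row `hF₁` (`FP/StepRecursionFeedNestedCompDoorPairingSummable.d1Tel_JcComp_nested_of_fedW_pairingCoclosed_wStep`
L.361: `hessKer (AF 1) (𝒱F 1) (𝒲F 1) μ ν z = Lc^8 · dressedEntry (wStep Lc 1) (TshotOf Lc (JcComp …) 1) (Lc•z) μ ν`) is road `TowerFAnchorRowW.hF₁_rec_w` at `w 0 := wF′ 0` followed by the dressing-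
invariance junction `hWT 0 : dressedEntry (wF′ 0) 𝒯_0 (Lc•z) μ ν = dressedEntry (wStep Lc 1) 𝒯_0 (Lc•z) μ ν`, `𝒯_0 := TshotOf Lc (JcComp …) 1`.  By road `DressedEntryWardInvariance` v2
(`dressedEntry_eq_of_bgrad_of_wardTransversal`) `hWT 0` follows from THREE letters: `hgauge 0` (the weight difference is a backward fine gradient of ONE potential per coarse source —
(J-W″)'s «response = column + gradient», by value A2-HQF0 γ ≤ 3.4e−14) and the two PRINTED table predicates `WardTransversal (flipK 𝒯_0)` ((5.9)) and `IndexSymmetric 𝒯_0` ((5.8)).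
THIS FILE records that at the anchor BOTH table predicates are ALREADY THEOREMS OF THE TREE for the (III′) literal of record: `TshotOf Lc (JcComp hLc N cΛ cB Rt P) 1 = TbalOf Lc
(JsB12CombShSym hLc N (symTablesAn1S2 3 Lc cΛ) cΛ cB) 0` (an2 `CompositeOneShotJetData.TshotOf_JcComp_one`), whose Ward transversality at every level is road g23's
`StepKernelWardDataRecord.wardRefl_JsB12CombShSym_an1TablesS2_pinned_of_locks` (M‴'s scalars only: `Odd Lc`, `2 ≤ Lc`, `2 ≤ N`, the unit locks `cΛ·Lc⁴ = 2`, `cB = −Lc¹²∕4`;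
its `hRm0` discharged by `CombRemainderParityAll.hRm0_discharged`) and whose index symmetry is `Gaps/D1RecordIndexSymmetry.indexSymmetric_TbalOf_JsB12CombShSym` (any table record).
HENCE `hWT 0 ⟸ hgauge 0` by name, and the consumer's `hF₁` TEXT follows from ANY anchor identity concluding `Lc^8 · dressedEntry (wF′ 0) 𝒯_0 (Lc•z)` (road `hF₁_rec_w`) plus `hgauge 0`.
For storeys j ≥ 1 the table `hessKer (AN Rt j) (VN Rt P j) (WN Rt P j)` (= `TshotOf … (j+1)`, (L2′)) has NO Ward theorem in the tree: there `hW𝒯 j` stays DISPLAYED (by value road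
R-FP-62-WARD (W2) ∕ TEL2 CONTROL C10).

WHAT ([folklore] composition BY NAME; no `def`, no `def … : Prop`, nothing cited, 0 sorry): §1 **`wardTransversal_flipK_TshotOf_JcComp_one`**, **`indexSymmetric_TshotOf_JcComp_one`**,
`absMoment₂_TshotOf_JcComp_one` (the anchor table's three letters, by name); §2 **`hWT_anchor_of_gauge`** — `∀ μ ν z, dressedEntry wF₀ (TshotOf … 1) ((Lc:ℤ)•z) μ ν =
dressedEntry (wStep Lc 1) (TshotOf … 1) ((Lc:ℤ)•z) μ ν` from `hgauge₀ : ∀ c a u, wF₀ c a u − wStep Lc 1 c a u = ζ a (u − e_c) − ζ a u` (+ `AbsMoment₂` of `wF₀`, `ζ`) and M‴'s scalars;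
§3 **`hF₁_of_anchor_of_gauge`** — the consumer's `hF₁` TEXT for ANY left-hand side `H μ ν z` (the END: `hessKer (AF 1) (𝒱F 1) (𝒲F 1) μ ν z`) from an anchor identity at the weight `wF₀`
(the END: road `TowerFAnchorRowW.hF₁_rec_w` at `w 0 := wF₀`) and `hgauge₀`.
WHAT THIS IS NOT: not `hgauge 0` (DISPLAYED; (J-W″) by value); not the j ≥ 1 junctions; not an instantiation of the END (the `--dressF` skeleton does that, xread); nothing of Bałaban's
asserted, valued or discharged; 0 estimates; 0∕4 row-D1 binders (hW, hR, D1Tel, D1Rep); ROOT M‴ p325680 untouched (its theorems are USED, by name); NOT (C1), NOT (T-ID), NOT D1,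
NEVER «G-an2-4 closed», NOT BetaPertH, NOT continuum, NOT Clay.

HONEST DEPENDENCY (page 1, mandatory): continuum YM on T⁴ ⇐ BetaPertH ∧ nine spine estimates (0/9 proved); BetaPertH ⇐ (D1) ∧ (D4) ∧ CAP+tail;
G-an2-4 gates asym, D1 and NE2/3/4.  HONEST FRAMING (cell contract, verbatim): «discharging `BetaPertH` makes Bałaban's UV stability UNCONDITIONAL —
a real constructive-QFT result; it is NOT the continuum limit and NOT the Clay problem.»  ABSOLUTE RULE (cell charter, verbatim): «No internally-minted
statement may enter as a cited fact. Every hypothesis is either kernel-proved in this package or a verbatim quotation of a PUBLISHED theorem with page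
reference. The manuscript(s) under audit are NOT citable for their own disputed steps — they are the thing under adjudication; programme-internal
(2001/route/tribunal) claims are never citable.»  Road «FP» OWNER, b2b-balaban-beta-d1-p3 gen 62, 2026-08-30.  No existing file touched.
-/

noncomputable section

open scoped BigOperators

namespace Summit.QuantumFields.BalabanUV.Beta.FP.TowerFAnchorWardRecord

open Literature.MathematicalPhysics.QuantumFieldTheory.Balaban1983to89
open Literature.MathematicalPhysics.QuantumFieldTheory.Balaban1983to89.Beta
open Literature.MathematicalPhysics.QuantumFieldTheory.Balaban1983to89.Beta.DecimatedMomentSummable (AbsMoment₂)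
open Literature.MathematicalPhysics.QuantumFieldTheory.Balaban1983to89.Beta.DressedMomentNormalisation (EKer dressedEntry)
open Literature.MathematicalPhysics.QuantumFieldTheory.Balaban1983to89.Beta.OneStepKernelFamily (flipK TshotOf TbalOf absMoment₂_TshotOf)
open Literature.MathematicalPhysics.QuantumFieldTheory.Balaban1983to89.Beta.HessianTelescopingKKT (wStep absMoment₂_wStep)
open PolarizationSign (WardTransversal IndexSymmetric)
open Summit.QuantumFields.BalabanUV.Beta.CompositeOneShotJetData (Roots Pins JcComp TshotOf_JcComp_one)
open Summit.QuantumFields.BalabanUV.Beta.FP.StepKernelWardDataRecord (wardRefl_JsB12CombShSym_an1TablesS2_pinned_of_locks)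
open Summit.QuantumFields.BalabanUV.Gaps.D1RecordIndexSymmetry (indexSymmetric_TbalOf_JsB12CombShSym)
open Summit.QuantumFields.BalabanUV.Beta.FP.DressedEntryWardInvariance (dressedEntry_eq_of_bgrad_of_wardTransversal)

variable {Lc : ℕ} [NeZero Lc]

/-! ## §1 The anchor table's letters, by name -/

/-- [folklore] **THE ANCHOR TABLE IS WARD-TRANSVERSE** (printed (5.9), `hessKer` convention): `WardTransversal (flipK (TshotOf Lc (JcComp …) 1))` — `TshotOf_JcComp_one` + road g23's
`wardRefl_JsB12CombShSym_an1TablesS2_pinned_of_locks` at level `0`, under M‴'s scalars only. -/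
theorem wardTransversal_flipK_TshotOf_JcComp_one (hLc : Odd Lc) (hL2 : 2 ≤ Lc) {N : ℕ} (hN : 2 ≤ N) (cΛ cB : ℝ)
    (hΛ : cΛ * (Lc : ℝ) ^ 4 = 2) (hcB : cB = -((Lc : ℝ) ^ 12 / 4)) (Rt : Roots Lc) (P : Pins) :
    WardTransversal (flipK (TshotOf Lc (JcComp hLc N cΛ cB Rt P) 1)) := by
  rw [TshotOf_JcComp_one]
  exact (wardRefl_JsB12CombShSym_an1TablesS2_pinned_of_locks hLc hL2 hN cΛ cB hΛ hcB).1 0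

/-- [folklore] **THE ANCHOR TABLE IS INDEX-SYMMETRIC** (printed (5.8)): `IndexSymmetric (TshotOf Lc (JcComp …) 1)` — `TshotOf_JcComp_one` + `indexSymmetric_TbalOf_JsB12CombShSym` (any locks). -/
theorem indexSymmetric_TshotOf_JcComp_one (hLc : Odd Lc) (N : ℕ) (cΛ cB : ℝ) (Rt : Roots Lc) (P : Pins) :
    IndexSymmetric (TshotOf Lc (JcComp hLc N cΛ cB Rt P) 1) := by
  rw [TshotOf_JcComp_one]
  exact indexSymmetric_TbalOf_JsB12CombShSym hLc N _ cΛ cB 0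

/-- [folklore] the anchor table has absolutely summable second moments in every channel (lit `absMoment₂_TshotOf`, any jet data). -/
theorem absMoment₂_TshotOf_JcComp_one (hLc : Odd Lc) (N : ℕ) (cΛ cB : ℝ) (Rt : Roots Lc) (P : Pins) (c e : Fin 4) :
    AbsMoment₂ (TshotOf Lc (JcComp hLc N cΛ cB Rt P) 1 c e) :=
  absMoment₂_TshotOf (JcComp hLc N cΛ cB Rt P) 1 c e

/-! ## §2 `hWT 0` from `hgauge 0` alone -/

/-- [folklore] **`hWT_anchor_of_gauge` — THE END's STOREY-0 DRESSING-INVARIANCE JUNCTION FROM THE GAUGE LETTER ALONE.**  For any weight `wF₀ : EKer 4` (the END: the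
renormalised true weight `(α 0)⁻¹ • wF Lc Q ℓ sn 0`) whose difference to the canonical step column `wStep Lc 1` is, in `dressedEntry`'s weight variable, the BACKWARD fine
gradient of ONE potential `ζ a` per coarse source (`hgauge₀`), the anchor table of the (III′) literal of record is dressed identically by `wF₀` and by `wStep Lc 1`:
`dressedEntry wF₀ (TshotOf … 1) ((Lc:ℤ)•z) μ ν = dressedEntry (wStep Lc 1) (TshotOf … 1) ((Lc:ℤ)•z) μ ν` — road `dressedEntry_eq_of_bgrad_of_wardTransversal` fed §1. -/
theorem hWT_anchor_of_gauge (hLc : Odd Lc) (hL2 : 2 ≤ Lc) {N : ℕ} (hN : 2 ≤ N) (cΛ cB : ℝ)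
    (hΛ : cΛ * (Lc : ℝ) ^ 4 = 2) (hcB : cB = -((Lc : ℝ) ^ 12 / 4)) (Rt : Roots Lc) (P : Pins)
    (wF₀ : EKer 4) (ζ : Fin 4 → (Fin 4 → ℤ) → ℝ) (hwF : ∀ κ l, AbsMoment₂ (wF₀ κ l)) (hζ : ∀ a, AbsMoment₂ (ζ a))
    (hgauge₀ : ∀ (c a : Fin 4) (u : Fin 4 → ℤ), wF₀ c a u - wStep Lc 1 c a u = ζ a (u - Pi.single c 1) - ζ a u) :
    ∀ (μ ν : Fin 4) (z : Fin 4 → ℤ),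
      dressedEntry wF₀ (TshotOf Lc (JcComp hLc N cΛ cB Rt P) 1) ((Lc : ℤ) • z) μ ν
        = dressedEntry (wStep Lc 1) (TshotOf Lc (JcComp hLc N cΛ cB Rt P) 1) ((Lc : ℤ) • z) μ ν :=
  fun μ ν z => dressedEntry_eq_of_bgrad_of_wardTransversal wF₀ (wStep Lc 1) (TshotOf Lc (JcComp hLc N cΛ cB Rt P) 1) ζ hwF
    (fun κ l => absMoment₂_wStep (Lc := Lc) 1 κ l) hζ (absMoment₂_TshotOf_JcComp_one hLc N cΛ cB Rt P) hgauge₀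
    (wardTransversal_flipK_TshotOf_JcComp_one hLc hL2 hN cΛ cB hΛ hcB Rt P) (indexSymmetric_TshotOf_JcComp_one hLc N cΛ cB Rt P) ((Lc : ℤ) • z) μ ν

/-! ## §3 The consumer's `hF₁` text from an anchor identity at the true weight -/

/-- [folklore] **`hF₁_of_anchor_of_gauge` — THE END CONSUMER's ANCHOR ROW `hF₁` UNDER (3a).**  If some kernel `H μ ν z` (the END: `hessKer (AF 1) (𝒱F 1) (𝒲F 1) μ ν z`) equals
`Lc^8 · dressedEntry wF₀ (TshotOf … 1) ((Lc:ℤ)•z) μ ν` (the END: road `TowerFAnchorRowW.hF₁_rec_w` at `w 0 := wF₀`), and `hgauge₀` holds, then `H` satisfies the consumer's `hF₁` TEXT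
`H μ ν z = Lc^8 · dressedEntry (wStep Lc 1) (TshotOf Lc (JcComp …) 1) ((Lc:ℤ)•z) μ ν` (`…PairingSummable` L.361). -/
theorem hF₁_of_anchor_of_gauge (hLc : Odd Lc) (hL2 : 2 ≤ Lc) {N : ℕ} (hN : 2 ≤ N) (cΛ cB : ℝ)
    (hΛ : cΛ * (Lc : ℝ) ^ 4 = 2) (hcB : cB = -((Lc : ℝ) ^ 12 / 4)) (Rt : Roots Lc) (P : Pins)
    (wF₀ : EKer 4) (ζ : Fin 4 → (Fin 4 → ℤ) → ℝ) (hwF : ∀ κ l, AbsMoment₂ (wF₀ κ l)) (hζ : ∀ a, AbsMoment₂ (ζ a))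
    (hgauge₀ : ∀ (c a : Fin 4) (u : Fin 4 → ℤ), wF₀ c a u - wStep Lc 1 c a u = ζ a (u - Pi.single c 1) - ζ a u)
    (H : Fin 4 → Fin 4 → (Fin 4 → ℤ) → ℝ)
    (hF₁w : ∀ (μ ν : Fin 4) (z : Fin 4 → ℤ),
      H μ ν z = (Lc : ℝ) ^ 8 * dressedEntry wF₀ (TshotOf Lc (JcComp hLc N cΛ cB Rt P) 1) ((Lc : ℤ) • z) μ ν) :
    ∀ (μ ν : Fin 4) (z : Fin 4 → ℤ),
      H μ ν z = (Lc : ℝ) ^ 8 * dressedEntry (wStep Lc 1) (TshotOf Lc (JcComp hLc N cΛ cB Rt P) 1) ((Lc : ℤ) • z) μ ν := by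
  intro μ ν z
  rw [hF₁w μ ν z, hWT_anchor_of_gauge hLc hL2 hN cΛ cB hΛ hcB Rt P wF₀ ζ hwF hζ hgauge₀ μ ν z]

end Summit.QuantumFields.BalabanUV.Beta.FP.TowerFAnchorWardRecord

end
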